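import Mathlib.Algebra.CharP.Basic
import Mathlib.Algebra.CharP.Lemmas
import Literature.Computability.AlgebraicComplexity.BurgisserBooleanParts
import Literature.Computability.Complexity.Counting
import Literature.Computability.Complexity.NPClosureProofs
import Literature.Computability.Complexity.CircuitEval
import HarnessLib

/-!
# Boolean parts of Valiant's classes over finite fields (Bürgisser 2000, Thm. 1.1(2) and
Cor. 1.2(2)): the decomposition of `burgisser_collapse_of_VP_eq_VNP_finite`

Trunk T-CPLX-ALG. This file decomposes the named fact
`Literature.PNP.burgisser_collapse_of_VP_eq_VNP_finite k` of `ValiantBooleanBridge.lean`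
(Bürgisser, *Cook's versus Valiant's hypothesis*, TCS 235 (2000), Cor. 1.2(2): if `VP_k = VNP_k`
over a finite field `k` of characteristic `p`, then
`NC²/poly = P/poly = NP/poly = Mod_pNP/poly = PH/poly`; the tree's fact records the two ends
`polyAdvice (NC 2) = polyAdvice PH`) along the printed proof (TCS 235, p. 79 and §5 (B), p. 87)
into named facts (D-0014), and PROVES the assembly from them.

## The printed proof (TCS 235, p. 79)

"In the case of a finite field `k` of characteristic `p` we argue as follows. If `VP_k = VNP_k`,
we get from Theorem 1.1 as above `#_pP/poly ⊆ FNC²/poly ⊆ FP/poly`. Switching to the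
corresponding classes of languages we obtain `Mod_pNP/poly ⊆ NC²/poly ⊆ P/poly ⊆ NP/poly`. By
invoking Theorem 3.1 we see that we have equality in the above chain of inclusions." Together
with (same page) "It is well-known that `P = NP` implies `P = PH` (cf. [12]). A similar argument
shows that `P/poly = NP/poly` implies `P/poly = PH/poly`", this is Cor. 1.2(2). Here
(p. 75) `Mod_pNP` is the set of languages `{x | φ(x) ≡ 1 mod p}` with `φ ∈ #P`, and Theorem 1.1(2)
(p. 73) reads: "For finite fields of characteristic `p` we have
`FNC¹/poly ⊆ BP(VP_k) ⊆ FNC²/poly`, `#_pP/poly = BP(VNP_k)`", proved in §5 (B), p. 87: "Our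
proofs for (A1) and (A2) can be immediately translated to show the inclusions
`FNC¹/poly ⊆ BP(VP_k)` and `#_pP/poly ⊆ BP(VNP_k)`. To prove `BP(VP_k) ⊆ FNC²/poly` we start as
in (A3) with straight-line programs `Γ_n` of size `n^{O(1)}` and depth `O(log² n)` using
constants in `k` [Thm. 2.5 = Valiant–Skyum–Berkowitz–Rackoff]. As `k` is finite, `Γ_n` can be
directly simulated by Boolean circuits of size `n^{O(1)}` and depth `O(log² n)`."

## The decomposition

* `ModpNP p` — Bürgisser's class `Mod_pNP` (p. 75), defined through the tree's `SharpP`;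
* **(B2)** `sharpP_booleanPart_VNP k` — `#P ⊆ BP(VNP_k)` in its uniform, characteristic-free
  form: every `#P` function is, on Boolean points, the value (cast into `k`) of a p-definable
  family; over a field of characteristic `p` this is the uniform part of `#_pP/poly ⊆ BP(VNP_k)`
  (§5 (B) with (A2)); **proved here** (`sharpP_booleanPart_VNP_holds`) by the arithmetisation of
  the verifier's `B₂`-programs of `BurgisserBooleanParts.lean` (Part II there);
* **(B3)** `booleanPart_VP_NC_two_of_finite k` — `BP(VP_k) ⊆ FNC²/poly` for finite `k`
  (Thm. 1.1(2), §5 (B): VSBR depth reduction, Thm. 2.5, and Boolean simulation of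
  `k`-arithmetic), in the language form consumed by the corollary; named fact;
* **(Thm. 3.1)** `polyAdvice_NP_subset_polyAdvice_ModpNP` — `NP/poly ⊆ Mod_pNP/poly` for every
  prime `p` (Valiant–Vazirani plus Adleman's trick, pp. 77–79); named fact;
* **(PH step)** `polyAdvice_PH_eq_of_polyAdvice_NP_eq` — "`P/poly = NP/poly` implies
  `P/poly = PH/poly`" (p. 79); named fact;

and the assembly, proved: `ModpNP p ⊆ NC 2` from (B2), `VP_k = VNP_k` and (B3)
(`ModpNP_subset_NC_two_of_VP_eq_VNP`, "`Mod_pNP/poly ⊆ NC²/poly`"), `NP ⊆ P/poly` from this and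
Thm. 3.1 (`NP_subset_PPoly_of_VP_eq_VNP_finite`), and the target fact from Thm. 3.1, (B3) and the
PH step (`burgisser_collapse_of_VP_eq_VNP_finite_of_facts`). The tree's facts used on the way:
`P/poly = P/poly-advice` (`PPoly_eq_polyAdvice_P_holds`, Arora–Barak Thm. 6.18),
`NP ⊆ NP/poly` (`NP_subset_polyAdvice_NP'`), `(P/poly)/poly ⊆ P/poly` (`polyAdvice_subset_PPoly`),
`P ⊆ NP`, `P ⊆ PH`, `P ⊆ P/poly`.

## Design choices

* `ModpNP p` uses the tree's `SharpP` (Arora–Barak Def. 17.2: witnesses of the exact length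
  `p |x|`), which is Bürgisser's `#P` (p. 74: witnesses of length `≤ t(|x|)`) as a class; the
  residue condition is `φ x % p = 1` on natural numbers.
* (B2) is stated for the tree's `SharpP` directly, over an arbitrary field: the identity
  `f_n(x) = (φ(x) : k)` on Boolean points reads `f_n(x) = φ(x)` in characteristic zero
  (`#P ⊆ BP(VNP_k)`, (A2)) and `f_n(x) = φ(x) mod p` in characteristic `p`
  (`#_pP ⊆ BP(VNP_k)`, (B)); the advice versions (`#P/poly`, `#_pP/poly`) are not needed for
  Cor. 1.2(2) and are not restated.
* (B3) is rendered at the level of languages, which is what Cor. 1.2(2) consumes ("switching to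
  the corresponding classes of languages", p. 79): for a p-computable family `f` over a finite
  field whose values on Boolean points lie in the prime field (the condition for `f` to have a
  Boolean part, Def. 2.1(1)(b) and Rem. 2.2(1), p. 75–76), each fibre language
  `{x | f_n(x) = a}` is in the tree's non-uniform `NC 2` (`B₂`-circuits of polynomial size and
  depth `c log² n + c`). The printed conclusion is that the bit string of `f_n(x) ∈ 𝔽_p`
  (`m = ⌊log p⌋ + 1 = O(1)` bits, `p` fixed with `k`) is computed in `FNC²/poly`; comparing
  `O(1)` output bits with a constant pattern costs `O(1)` extra gates and depth, so the present
  form is implied by the printed one.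
* Thm. 3.1 is stated verbatim (`polyAdvice NP ⊆ polyAdvice (ModpNP p)` for prime `p`); the
  assembly combines it with `NP ⊆ NP/poly`. The PH step is stated verbatim as printed on p. 79
  (`polyAdvice P = polyAdvice NP → polyAdvice P = polyAdvice PH`).
* Mathlib has no counting classes or advice classes (searched `ModP`, `ParityP`, `SharpP`:
  nothing); reused: `CharP.natCast_eq_natCast`, `CharP.char_is_prime`, `ringChar`,
  `Equiv.vectorEquivFin`, `Finset.card_equiv`.

## References

* P. Bürgisser, *Cook's versus Valiant's hypothesis*, Theoret. Comput. Sci. 235 (2000) 71–88: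
  Thm. 1.1(2) (p. 73), Cor. 1.2(2) (p. 74), §2 (p. 75: `#_pP`, `Mod_pNP`, `C/poly`, Def. 2.1),
  Thm. 2.5 (p. 77), Thm. 3.1 (p. 77, proof pp. 78–79), proof of Cor. 1.2 (p. 79), §5 (A2)
  (pp. 84–85) and (B) (p. 87).
* P. Bürgisser, *Completeness and Reduction in Algebraic Complexity Theory*, Springer 2000,
  Thm. 4.5 and Cor. 4.6(2) (the book version).
* L. G. Valiant, S. Skyum, S. Berkowitz, C. Rackoff, *Fast parallel computation of polynomials
  using few processors*, SIAM J. Comput. 12 (1983) 641–644 (Thm. 2.5 of the TCS paper).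
* L. G. Valiant, V. V. Vazirani, *NP is as easy as detecting unique solutions*, Theoret. Comput.
  Sci. 47 (1986) 85–93; L. Adleman, *Two theorems on random polynomial time*, FOCS 1978, 75–83
  (the ingredients of Thm. 3.1).
* R. M. Karp, R. J. Lipton, *Turing machines that take advice*, Enseign. Math. 28 (1982)
  (advice classes; the collapse remark).
* S. Arora, B. Barak, *Computational Complexity: A Modern Approach*, CUP 2009, Def. 6.16,
  Thm. 6.18, Def. 17.2.
-/

noncomputable section

open MvPolynomial Literature.Computability.Complexity Literature.Computability.Complexity.Nondeterministic Literature.Computability.Complexity.Classes Literature.Computability.AlgebraicComplexity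

namespace Literature.Computability.AlgebraicComplexity

universe u

/-! ### Bürgisser's class `Mod_pNP` -/

section ModpNP

/-- Bürgisser's counting class `Mod_pNP` (TCS 235, p. 75: "`Mod_pNP` is the set of languages
`{x ∈ {0,1}* | φ(x) ≡ 1 mod p}`, where `φ ∈ #P`"), over the tree's `SharpP` (Valiant's `#P`,
witnesses of length exactly `p |x|`, Arora–Barak 2009, Def. 17.2; the same class of functions as
Bürgisser's `#P` of p. 74, witnesses of length `≤ t(|x|)`). For `p = 2` this is `⊕P`.
[cite: Burgisser2000TCS, §2 p. 75] -/
def ModpNP (p : ℕ) : Set (Language Bool) :=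
  {L | ∃ φ ∈ SharpP, ∀ x : List Bool, x ∈ L ↔ φ x % p = 1}

/-- Unfolding of `ModpNP`. [cite: Burgisser2000TCS, §2 p. 75] -/
theorem mem_ModpNP_iff {p : ℕ} {L : Language Bool} :
    L ∈ ModpNP p ↔ ∃ φ ∈ SharpP, ∀ x : List Bool, x ∈ L ↔ φ x % p = 1 :=
  Iff.rfl

end ModpNP

/-! ### The named facts (B2), (B3), Thm. 3.1 and the PH step -/

section Facts

variable (k : Type u) [Field k]

/-- **(B2)** (Bürgisser 2000 TCS, §5 (A2), pp. 84–85: "`#P ⊆ BP(VNP_k)`", and §5 (B), p. 87: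
"Our proofs for (A1) and (A2) can be immediately translated to show the inclusions
`FNC¹/poly ⊆ BP(VP_k)` and `#_pP/poly ⊆ BP(VNP_k)`"; the uniform part, stated characteristic-free
for the tree's `SharpP`): for every `φ ∈ #P` there is a p-definable family `f = (f_n)`,
`f_n ∈ k[X_1, …, X_n]`, with `f_n(x) = φ(x) · 1_k` for all `x ∈ {0,1}ⁿ`. In characteristic zero
this says that (the bit string of) `φ` is a Boolean part of `f` (Def. 2.1(1)(a)); in
characteristic `p` that `φ mod p ∈ #_pP` is the Boolean part of `f` (Def. 2.1(1)(b)). Printed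
proof: Cook's theorem gives 3-CNFs `φ_n(x, y)` counting the accepting computations; with clause
polynomials `g_K`, `f_n = ∏_K g_K` is p-computable and `g_n = ∑_{y ∈ {0,1}^m} f_n(X, y)` is
p-definable with `g_n(x) = φ(x)`. Discharged below (`sharpP_booleanPart_VNP_holds`) with the gates
of the verifier's `B₂`-programs arithmetised directly (`certCountPoly` of
`BurgisserBooleanParts.lean`); users are fed `sharpP_booleanPart_VNP_holds k`.
[cite: Burgisser2000TCS, §5 (A2) pp. 84–85 and §5 (B) p. 87] -/
def sharpP_booleanPart_VNP : Prop :=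
  ∀ φ ∈ SharpP, ∃ f : ∀ n, MvPolynomial (Fin n) k,
    IsVNPFamily f ∧ ∀ n (x : Fin n → Bool), eval (boolPoint k x) (f n) = (φ (List.ofFn x) : k)

/-- **(B3)** (Bürgisser 2000 TCS, Thm. 1.1(2), p. 73: "For finite fields of characteristic `p`
we have `FNC¹/poly ⊆ BP(VP_k) ⊆ FNC²/poly`", second inclusion; proof §5 (B), p. 87: "To prove
`BP(VP_k) ⊆ FNC²/poly` we start as in (A3) with straight-line programs `Γ_n` of size `n^{O(1)}`
and depth `O(log² n)` using constants in `k` [by Thm. 2.5, the depth reduction of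
Valiant–Skyum–Berkowitz–Rackoff: size `O(d⁶ L(f)³)`, depth `O(log(d L(f)) log d + log n)`]. As
`k` is finite, `Γ_n` can be directly simulated by Boolean circuits of size `n^{O(1)}` and depth
`O(log² n)`"), in the language form used in the proof of Cor. 1.2(2) ("switching to the
corresponding classes of languages", p. 79): let `k` be a finite field and `f = (f_n)`,
`f_n ∈ k[X_1, …, X_n]`, a p-computable family whose values on Boolean points lie in the prime
field (i.e. `f` has a Boolean part, Def. 2.1(1)(b), Rem. 2.2(1)); then for every `a ∈ k` the
language `{x ∈ {0,1}* | f_{|x|}(x) = a}` is decided by `B₂`-circuit families of polynomial size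
and depth `O(log² n)`, i.e. lies in the tree's (non-uniform) `NC 2 = NC²/poly`. The printed
conclusion computes the `m = ⌊log p⌋ + 1 = O(1)` bits of `f_n(x) ∈ 𝔽_p` in `FNC²/poly`;
comparing them with the bits of `a` costs `O(1)` further gates and depth, so this form is implied
by the printed one. Book version: Bürgisser 2000, Thm. 4.5.
[cite: Burgisser2000TCS, Thm. 1.1(2) p. 73 and §5 (B) p. 87, with Thm. 2.5 p. 77] [cite: ValiantSkyumBerkowitzRackoff1983] [cite: Burgisser2000, Thm. 4.5] -/
def booleanPart_VP_NC_two_of_finite : Prop :=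
  ∀ [Finite k] (f : ∀ n, MvPolynomial (Fin n) k), IsVPFamily f →
    (∀ n (x : Fin n → Bool), ∃ N : ℕ, eval (boolPoint k x) (f n) = N) →
      ∀ a : k, {w : List Bool | eval (boolPoint k w.get) (f w.length) = a} ∈ NC 2

/-- **Theorem 3.1** (Bürgisser 2000 TCS, p. 77: "For a prime `p` we have
`NP/poly ⊆ Mod_pNP/poly`"; proof pp. 78–79: a nonuniform polynomial-time map `ψ ↦ φ` on CNFs with
`#ψ > 0 ⇔ #φ ≡ 1 mod p`, obtained from the Valiant–Vazirani reduction [27] (`#ψ = 0 ⇒ #ψ_w = 0`,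
`#ψ > 0 ⇒ Prob[#ψ_w ≠ 1] ≤ 1 - (4n)⁻¹`), the CNF arithmetic of Lemma 3.2
(`#φ = 1 + ∏_j (p - 1 + #ψ_j)`), amplification over `q = a^{O(1)}` independent `w_j` and Adleman's
trick [1] fixing `w_1, …, w_q` as advice for all CNFs of size `a`). With the tree's advice
operator `polyAdvice` (Arora–Barak Def. 6.16, the pairing `boolPair`; Bürgisser's `C/poly`,
p. 75, uses the same Karp–Lipton definition) and `ModpNP`. Named fact (D-0014).
[cite: Burgisser2000TCS, Thm. 3.1 p. 77, proof pp. 78–79] [cite: ValiantVazirani1986] [cite: Adleman1978] -/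
def polyAdvice_NP_subset_polyAdvice_ModpNP : Prop :=
  ∀ p : ℕ, p.Prime → polyAdvice NP ⊆ polyAdvice (ModpNP p)

/-- **The PH step** (Bürgisser 2000 TCS, p. 79, proof of Cor. 1.2: "It is well-known that
`P = NP` implies `P = PH` (cf. [12]). A similar argument shows that `P/poly = NP/poly` implies
`P/poly = PH/poly`"; Karp–Lipton 1982 for advice classes), verbatim with the tree's `polyAdvice`,
`P`, `NP = Σ₁ᵖ` and `PH = ⋃ₖ Σₖᵖ` (quantifier definition, `PolyHierarchy.lean`). The "similar
argument": if `NP ⊆ P/poly` then by induction `Σₖ₊₁ᵖ = ∃ᵖ·coΣₖᵖ ⊆ ∃ᵖ·(P/poly) ⊆ NP/poly ⊆ P/poly`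
(the advice for the finitely many relevant witness lengths is concatenated), hence
`PH ⊆ P/poly` and `PH/poly = P/poly`. Named fact (D-0014).
[cite: Burgisser2000TCS, p. 79 proof of Cor. 1.2] [cite: KarpLipton1980] -/
def polyAdvice_PH_eq_of_polyAdvice_NP_eq : Prop :=
  polyAdvice P = polyAdvice NP → polyAdvice P = polyAdvice PH

end Facts

/-! ### Proof of (B2): `#P` functions are Boolean values of p-definable families -/

section B2

open scoped Classical

variable {k : Type u} [Field k]

/-- The number of witnesses of exact length `m` (the tree's `countWitnesses`, over
`List.Vector Bool m`) is the number of bit vectors `y : Fin m → Bool` with `⟨x, y⟩ ∈ R`. [folklore] -/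
theorem countWitnesses_eq_card_fun (R : Language Bool) (m : ℕ) (x : List Bool) :
    countWitnesses R m x =
      (Finset.univ.filter fun y : Fin m → Bool => boolPair x (List.ofFn y) ∈ R).card := by
  unfold countWitnesses
  refine Finset.card_equiv (Equiv.vectorEquivFin Bool m) fun v => ?_
  simp only [Finset.mem_filter, Finset.mem_univ, true_and]
  have hv : List.ofFn ((Equiv.vectorEquivFin Bool m) v) = v.toList := by
    change List.ofFn v.get = v.toList
    rcases v with ⟨l, rfl⟩
    exact List.ofFn_get l
  rw [hv]

/-- **Discharge of (B2)** `sharpP_booleanPart_VNP k` (Bürgisser 2000 TCS, §5 (A2), pp. 84–85,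
and §5 (B), p. 87): for `φ ∈ #P` with relation `R ∈ P` and witness length `p`, the relation on
pairs `⟨x, y⟩`, `|x| = n`, `|y| = p(n)`, has `B₂`-programs of polynomial size (`P ⊆ P/poly`,
`exists_cktSize_boolPair_of_mem_PPoly`); the Boolean sum of the arithmetisation `H_{n,p(n)}` of
such a program (`certCountPoly`, `sum_eval_certCountPoly` of `BurgisserBooleanParts.lean`) is a
p-definable family in `X_1, …, X_n` taking the value `#{y ∈ {0,1}^{p(n)} | ⟨x, y⟩ ∈ R} = φ(x)`
(cast into `k`) at `x ∈ {0,1}ⁿ`. [cite: Burgisser2000TCS, §5 (A2) pp. 84–85 and §5 (B) p. 87] -/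
theorem sharpP_booleanPart_VNP_holds (k : Type u) [Field k] : sharpP_booleanPart_VNP k := by
  intro φ hφ
  obtain ⟨R, hRP, p, hp⟩ := hφ
  obtain ⟨q, hq⟩ := exists_cktSize_boolPair_of_mem_PPoly (P_subset_PPoly_holds hRP)
  simp only [CktSize] at hq
  choose gs out hlen hR using hq
  -- the witness length and the number of Boolean-sum variables
  set pf : ℕ → ℕ := fun n => p.eval n with hpf_def
  set U : ℕ → ℕ := fun n => pf n + ((2 * n + 2 + pf n) + q.eval (2 * n + 2 + pf n)) with hU_def
  have hpf : IsPBounded pf := (isPBounded_iff_exists_polynomial_holds pf).2 ⟨p, fun n => le_rfl⟩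
  have hU : IsPBounded U := by
    refine (isPBounded_iff_exists_polynomial_holds U).2
      ⟨p + ((2 * Polynomial.X + 2 + p) + q.comp (2 * Polynomial.X + 2 + p)), fun n => le_of_eq ?_⟩
    simp [hU_def, hpf_def]
  have hs : ∀ n, pf n + (gs n (pf n)).length ≤ U n := by
    intro n
    have h1 := hlen n (pf n)
    simp only [hU_def]
    omega
  have hB : ∀ n, ∀ g ∈ gs n (pf n), g.arity ≤ 2 := fun n g hg => (hR n (pf n)).isOver g hg
  -- the `VP` witness `H_{n, p(n)}` and its Boolean sum
  let g : ∀ n, MvPolynomial (Fin n ⊕ Fin (U n + 1)) k := fun n =>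
    certCountPoly n (pf n) (U n) (pf n) (gs n (pf n)) (out n (pf n) ())
  have hdeg : ∀ n, (g n).totalDegree ≤ 4 * U n + 2 := fun n =>
    totalDegree_certCountPoly_le (hB n) (hs n) _
  have hgVP : IsVPFamily g := by
    refine ⟨⟨?_, ?_⟩, ?_⟩
    · refine (IsPBounded.add_holds IsPBounded.id
        (IsPBounded.add_holds hU (IsPBounded.const 1))).mono fun n => ?_
      simp
    · exact (IsPBounded.add_holds (IsPBounded.mul_holds (IsPBounded.const 4) hU)
        (IsPBounded.const 2)).mono hdeg
    · exact (IsPBounded.add_holds (IsPBounded.mul_holds (IsPBounded.const 67) hU)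
        (IsPBounded.const 5)).mono fun n => complexity_certCountPoly_le (hB n) (hs n) _
  refine ⟨fun n => boolSum (g n), ⟨⟨⟨1, fun n => by simp⟩, ?_⟩, fun n => U n + 1, g, hgVP,
    fun n => rfl⟩, fun n x => ?_⟩
  · exact (IsPBounded.add_holds (IsPBounded.mul_holds (IsPBounded.const 4) hU)
      (IsPBounded.const 2)).mono fun n => (totalDegree_boolSum_le _).trans (hdeg n)
  · -- the counting identity `(∑_e H_{n,p(n)}(x, e)) = #{y ∈ {0,1}^{p(n)} | ⟨x, y⟩ ∈ R} = φ(x)`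
    rw [eval_boolSum]
    simp only [g, ← boolPoint_sumElim]
    rw [sum_eval_certCountPoly (hR n (pf n)).wf (fun j hj => (hR n (pf n)).outOK () j hj) le_rfl
      (hs n), hp, List.length_ofFn, countWitnesses_eq_card_fun]
    congr 1
    refine congrArg Finset.card (Finset.filter_congr fun y _ => ?_)
    rw [(hR n (pf n)).eval]
    simp only [Sum.elim_inl, Sum.elim_inr]
    rw [← Set.mem_iff_boolIndicator]
    rfl

end B2

/-! ### Assembly -/

section Assembly

variable {k : Type u} [Field k]

/-- `NCⁱ ⊆ P/poly` for every `i`: forget the depth bound (Arora–Barak 2009, Def. 6.23 and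
Def. 6.5; the case `i = 1` is `NC1_subset_PPoly`). [cite: AroraBarak2009, Def. 6.23 and Def. 6.5] -/
theorem NC_subset_PPoly (i : ℕ) : NC i ⊆ PPoly := by
  rintro L ⟨c, p, C, hC, hL⟩
  exact Set.mem_iUnion.2 ⟨p, C, fun n => ⟨(hC n).1, (hC n).2.2⟩, hL⟩

/-- In characteristic `p`, `(N : k) = 1 ↔ N % p = 1` (the residue condition of `Mod_pNP` read in
the field; Bürgisser 2000 TCS, p. 75 and Def. 2.1(1)(b)). [folklore] -/
theorem natCast_eq_one_iff_mod (p : ℕ) [CharP k p] (N : ℕ) : (N : k) = 1 ↔ N % p = 1 := by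
  have hp1 : p ≠ 1 := CharP.char_ne_one k p
  rw [← Nat.cast_one, CharP.natCast_eq_natCast k p, Nat.ModEq, Nat.one_mod_eq_one.2 hp1]

/-- **`Mod_pNP ⊆ NC²/poly` from `VP_k = VNP_k` over a finite field of characteristic `p`**
(Bürgisser 2000 TCS, p. 79: "`#_pP/poly ⊆ BP(VNP_k) = BP(VP_k) ⊆ FNC²/poly` … switching to the
corresponding classes of languages we obtain `Mod_pNP/poly ⊆ NC²/poly`"; the uniform part, which
is all the corollary needs): for `L ∈ Mod_pNP` with `φ ∈ #P`, (B2) gives a p-definable `f` with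
`f_n(x) = φ(x) mod p` on Boolean points, `VP_k = VNP_k` makes `f` p-computable, and (B3) decides
`f_n(x) = 1`, i.e. `φ(x) ≡ 1 mod p`, in `NC²`. [cite: Burgisser2000TCS, proof of Cor. 1.2(2) p. 79] -/
theorem ModpNP_subset_NC_two_of_VP_eq_VNP [Finite k] (p : ℕ) [CharP k p]
    (hB3 : booleanPart_VP_NC_two_of_finite k) (h : VP k = VNP k) : ModpNP p ⊆ NC 2 := by
  intro L hL
  obtain ⟨φ, hφ, hLφ⟩ := hL
  obtain ⟨f, hf, hfφ⟩ := sharpP_booleanPart_VNP_holds k φ hφ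
  have hmem := hB3 f (isVPFamily_of_VP_eq_VNP h hf) (fun n x => ⟨_, hfφ n x⟩) 1
  have hEq : L = {w : List Bool | eval (boolPoint k w.get) (f w.length) = 1} := by
    ext w
    change w ∈ L ↔ eval (boolPoint k w.get) (f w.length) = 1
    rw [hfφ w.length w.get, List.ofFn_get, natCast_eq_one_iff_mod p, hLφ w]
  rw [hEq]
  exact hmem

/-- **`NP ⊆ P/poly` from `VP_k = VNP_k` over a finite field** (Bürgisser 2000 TCS, p. 79, the
chain `NP/poly ⊆ Mod_pNP/poly ⊆ NC²/poly ⊆ P/poly` with Thm. 3.1): `NP ⊆ NP/poly`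
(`NP_subset_polyAdvice_NP'`) `⊆ Mod_pNP/poly` (Thm. 3.1, `p = char k` prime)
`⊆ NC²/poly-advice` (`ModpNP_subset_NC_two_of_VP_eq_VNP`) `⊆ P/poly` (advice is hard-wired,
`polyAdvice_subset_PPoly`). [cite: Burgisser2000TCS, proof of Cor. 1.2(2) p. 79] -/
theorem NP_subset_PPoly_of_VP_eq_VNP_finite [Finite k]
    (h31 : polyAdvice_NP_subset_polyAdvice_ModpNP) (hB3 : booleanPart_VP_NC_two_of_finite k)
    (h : VP k = VNP k) : NP ⊆ PPoly := by
  haveI : CharP k (ringChar k) := ringChar.charP k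
  have hprime : (ringChar k).Prime := CharP.char_is_prime k (ringChar k)
  calc NP ⊆ polyAdvice NP := NP_subset_polyAdvice_NP'
    _ ⊆ polyAdvice (ModpNP (ringChar k)) := h31 _ hprime
    _ ⊆ polyAdvice (NC 2) := polyAdvice_mono (ModpNP_subset_NC_two_of_VP_eq_VNP _ hB3 h)
    _ ⊆ PPoly := polyAdvice_subset_PPoly (NC_subset_PPoly 2)

/-- **`NP/poly ⊆ NC²/poly`** in the same situation (Bürgisser 2000 TCS, p. 79: equality in
`Mod_pNP/poly ⊆ NC²/poly ⊆ P/poly ⊆ NP/poly` by Thm. 3.1). [cite: Burgisser2000TCS, proof of Cor. 1.2(2) p. 79] -/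
theorem polyAdvice_NP_subset_polyAdvice_NC_two_of_VP_eq_VNP_finite [Finite k]
    (h31 : polyAdvice_NP_subset_polyAdvice_ModpNP) (hB3 : booleanPart_VP_NC_two_of_finite k)
    (h : VP k = VNP k) : polyAdvice NP ⊆ polyAdvice (NC 2) := by
  haveI : CharP k (ringChar k) := ringChar.charP k
  have hprime : (ringChar k).Prime := CharP.char_is_prime k (ringChar k)
  calc polyAdvice NP ⊆ polyAdvice (ModpNP (ringChar k)) := h31 _ hprime
    _ ⊆ polyAdvice (NC 2) := polyAdvice_mono (ModpNP_subset_NC_two_of_VP_eq_VNP _ hB3 h)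

/-- **The target fact from the decomposition**: `burgisser_collapse_of_VP_eq_VNP_finite k`
(Bürgisser 2000 TCS, Cor. 1.2(2); book Cor. 4.6(2)) follows from Thm. 3.1
`polyAdvice_NP_subset_polyAdvice_ModpNP`, (B3) `booleanPart_VP_NC_two_of_finite k` and the PH
step `polyAdvice_PH_eq_of_polyAdvice_NP_eq`, the inclusion (B2) and the bookkeeping facts
`PPoly = polyAdvice P`, `NP ⊆ polyAdvice NP` being proved in the tree. Proof, as on p. 79:
`polyAdvice (NC 2) ⊆ P/poly = polyAdvice P ⊆ polyAdvice PH`; conversely `NP ⊆ P/poly`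
(`NP_subset_PPoly_of_VP_eq_VNP_finite`) gives `polyAdvice P = polyAdvice NP`, the PH step gives
`polyAdvice PH = polyAdvice P ⊆ polyAdvice NP ⊆ polyAdvice (NC 2)`.
[cite: Burgisser2000TCS, Cor. 1.2(2) p. 74 and its proof p. 79] [cite: Burgisser2000, Cor. 4.6(2)] -/
theorem burgisser_collapse_of_VP_eq_VNP_finite_of_facts
    (h31 : polyAdvice_NP_subset_polyAdvice_ModpNP) (hB3 : booleanPart_VP_NC_two_of_finite k)
    (hPH : polyAdvice_PH_eq_of_polyAdvice_NP_eq) :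
    burgisser_collapse_of_VP_eq_VNP_finite k := by
  intro _ h
  have hNP : NP ⊆ PPoly := NP_subset_PPoly_of_VP_eq_VNP_finite h31 hB3 h
  have hPNP : polyAdvice P = polyAdvice NP := by
    refine Set.Subset.antisymm (polyAdvice_mono P_subset_NP_holds) ?_
    calc polyAdvice NP ⊆ PPoly := polyAdvice_subset_PPoly hNP
      _ = polyAdvice P := PPoly_eq_polyAdvice_P_holds
  have hPPH : polyAdvice P = polyAdvice PH := hPH hPNP
  refine Set.Subset.antisymm ?_ ?_
  · calc polyAdvice (NC 2) ⊆ PPoly := polyAdvice_subset_PPoly (NC_subset_PPoly 2)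
      _ = polyAdvice P := PPoly_eq_polyAdvice_P_holds
      _ ⊆ polyAdvice PH := polyAdvice_mono P_subset_PH
  · calc polyAdvice PH = polyAdvice P := hPPH.symm
      _ ⊆ polyAdvice NP := polyAdvice_mono P_subset_NP_holds
      _ ⊆ polyAdvice (NC 2) := polyAdvice_NP_subset_polyAdvice_NC_two_of_VP_eq_VNP_finite h31 hB3 h

/-- The remaining equalities of the printed chain in this situation: `NC²/poly = P/poly`
(`polyAdvice (NC 2) = PPoly`) and `P/poly = NP/poly` (`PPoly = polyAdvice NP`)
(Bürgisser 2000 TCS, Cor. 1.2(2): "`NC²/poly = P/poly = NP/poly = Mod_pNP/poly = PH/poly`").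
[cite: Burgisser2000TCS, Cor. 1.2(2) p. 74] -/
theorem polyAdvice_NC_two_eq_PPoly_of_VP_eq_VNP_finite [Finite k]
    (h31 : polyAdvice_NP_subset_polyAdvice_ModpNP) (hB3 : booleanPart_VP_NC_two_of_finite k)
    (h : VP k = VNP k) : polyAdvice (NC 2) = PPoly ∧ PPoly = polyAdvice NP := by
  have hNP : NP ⊆ PPoly := NP_subset_PPoly_of_VP_eq_VNP_finite h31 hB3 h
  have h1 : polyAdvice (NC 2) ⊆ PPoly := polyAdvice_subset_PPoly (NC_subset_PPoly 2)
  have h2 : PPoly ⊆ polyAdvice NP := by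
    calc PPoly = polyAdvice P := PPoly_eq_polyAdvice_P_holds
      _ ⊆ polyAdvice NP := polyAdvice_mono P_subset_NP_holds
  have h3 : polyAdvice NP ⊆ polyAdvice (NC 2) :=
    polyAdvice_NP_subset_polyAdvice_NC_two_of_VP_eq_VNP_finite h31 hB3 h
  exact ⟨Set.Subset.antisymm h1 (h2.trans h3), Set.Subset.antisymm h2 (h3.trans h1)⟩

end Assembly

end Literature.Computability.AlgebraicComplexity
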